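import Summits.AtomisticToContinuum.HydrodynamicLimit.Theorems.OneFlightGossipEngineCollisionActivityTailsUncActMeasurable
import HarnessLib

/-!
# `CollisionActivityTails` (stmt-AtomisticToContinuum-13734), line `plaque-thinning-count-ld`: measurability of the
untagged cold activity with TWO tagging thresholds (stub `stub_uncActMeasurableTT`)

Helper file (`--supports stmt-AtomisticToContinuum-13734`) for the crux
`Summit.AtomisticToContinuum.HydrodynamicLimit.Theses.OneFlightGossipEngine.CollisionActivityTails`, skeleton line
`plaque-thinning-count-ld` (`Cruxes/CollisionActivityTails/Lines/plaque_thinning_count_ld.lean`, v12), registered stub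
M₂ `stub_uncActMeasurableTT : UncActMeasurable₂` (an assembly piece of `lmgf_assembly`): for every diameter `σ`, particle
number, flow `Φ`, caps `Θ, yc, yk, K`, window `τ`, start `s` and particle `i`, the untagged cold activity
`uncAct₂ Θ yc yk K Φ τ s i` (count threshold `yc`, kinetic threshold `yk`), extended by `0` off the good set, is a
MEASURABLE function of the initial datum. Law-free.

This is the two-threshold PORT of the landed one-threshold file `…CollisionActivityTailsUncActMeasurable`
(`stub_uncActMeasurable : UncActMeasurable`), whose scalar tools, ramps, engine and passage to the limit are reused by
import. The vocabulary `Tagged₂`, `uncAct₂`, `UncActMeasurable₂` of §0/§3 is a VERBATIM copy of the skeleton's, over the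
landed copies `imp`, `relSpeed`, `scaleRadius`, `ballKinetic`, `rec` of `…CollisionActivityTailsPlaqueSplit` (all copies
across the `CollisionActivityTails` files are syntactically identical; the skeleton bridges definitionally). This file
lives in its own namespace.

## The argument (as in the template, with the count ramp at `yc` and the kinetic ramp at `yk`)

`uncAct₂` is `(σ/τ) ·` a collision pair sum over the window `(s, s + w]` whose summand at the collision `(t, k, l)` is
`w_{kl}(Φ_t z) · |v_k(t) − v_k(t⁻)|` with the `{0,1}`-valued WEIGHT
`w_{kl}(cfg) = 𝟙{k = i} 𝟙{relSpeed cfg k l ≤ Θ} 𝟙{¬ Tagged₂ yc yk K cfg i}` (on the good set the recorded pre-collisional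
velocity is the left limit, `IsHardSphereTrajectory.ofConfig_preVel_eq_leftLim`; `uncAct₂_eq_impulsePairSum`).

* §1: the weight is a DOUBLE pointwise limit of continuous weights. `¬ Tagged₂` is the conjunction over the scales
  `K' ≥ max K 1` of the open conditions `#{j : dist ≤ r_{K'}} < yc K'` and `ballKinetic < yk K'`; truncated at the
  scales `K' < L` (`scalesBelow`, `uncWeightBelow₂`) it is eventually (in `L`) equal to the full weight
  (`tendsto_uncWeightBelow₂`). At fixed `L` every factor is a limit of continuous functions of the configuration with
  ONE common rank `m`: `𝟙{relSpeed ≤ Θ} = lim ramp_m (relSpeed)` (`tendsto_ramp`), and for the upper continuous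
  approximations `rampCount ↓ nearCount`, `rampKinetic ↓ ballKinetic` the clamps `min 1 (max 0 (m (c − s_m))) → 𝟙{x < c}`
  (`tendsto_clamp_mul_sub`) with `c = yc K'` for the count and `c = yk K'` for the kinetic energy; finite products of
  convergent sequences converge (`tendsto_untagApprox₂`, `tendsto_uncWeightApprox₂`).
* §2: for a CONTINUOUS weight the weighted impulse sum, extended by `0` off the good set, is measurable
  (`measurable_indicator_impulsePairSum_of_continuous`, engine `measurable_indicator_collisionPairSum_cfg_torus` of
  `…CfgCollisionSums`), and measurability passes to pointwise limits of the weights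
  (`measurable_indicator_impulsePairSum_of_tendsto`). Two passages to the limit give `measurable_indicator_uncAct₂`.

References: C. Cercignani, R. Illner, M. Pulvirenti, *The Mathematical Theory of Dilute Gases* (1994), §4.2, App. 4.A
(collision sums along the hard-sphere flow, measurability in the datum); I. Gallagher, L. Saint-Raymond, B. Texier,
*From Newton to Boltzmann* (2013), §4.1 (collisions of the hard-sphere flow). Elementary; recorded here.
-/

noncomputable section

open MeasureTheory Set Filter Topology Function
open scoped ENNReal

namespace Summit.AtomisticToContinuum.HydrodynamicLimit.Theorems.CollisionActivityTailsUncActMeasurableTT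

open Literature.MathematicalPhysics.KineticTheory Literature.Analysis.FluidPDE
open Summit.AtomisticToContinuum.HydrodynamicLimit.Theorems.CollisionActivityTailsActivityDomination
  (Flow Cfg window act tdist nearCount)
open Summit.AtomisticToContinuum.HydrodynamicLimit.Theorems.CollisionActivityTailsCrowdedActivityMeasurable
  (ramp continuous_ramp tendsto_ramp)
open Summit.AtomisticToContinuum.HydrodynamicLimit.Theorems.CollisionActivityTailsPlaqueSplit
  (imp relSpeed scaleRadius ballKinetic tendsto_clamp_mul_sub rampCount rampKinetic continuous_rampCount
    continuous_rampKinetic tendsto_rampCount natCast_nearCount_le_rampCount tendsto_rampKinetic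
    ballKinetic_le_rampKinetic scalesBelow continuous_relSpeed_config impulsePairSum
    measurable_indicator_impulsePairSum_of_continuous measurable_indicator_impulsePairSum_of_tendsto)

/-! ## §0 Vocabulary (VERBATIM copies of the skeleton's `Tagged₂`, `uncAct₂`) -/

variable {σ : ℝ} {N : ℕ}

/-- Particle `i` is **tagged with two thresholds** (count threshold `yc`, kinetic threshold `yk`, minimal scale `K`) in
the configuration `cfg`: at some scale `K' ≥ max K 1` the ball of mean occupancy `K'` around `i` holds at least `yc K'`
centres OR kinetic energy (twice) at least `yk K'`. `Tagged y K` of v4–v11 is the diagonal `yc = yk = y`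
(definitionally). -/
def Tagged₂ (yc yk : ℝ) (K : ℕ) (cfg : Cfg N) (i : Fin (N + 1)) : Prop :=
  ∃ K' : ℕ, K ≤ K' ∧ 1 ≤ K' ∧
    (yc * K' ≤ (nearCount cfg i (scaleRadius N K') : ℝ) ∨ yk * K' ≤ ballKinetic cfg i (scaleRadius N K'))

open scoped Classical in
/-- **Untagged cold activity** `uncAct₂`: `(σ/τ) Σ |Δv_i|` over the collisions of `i` in `(s, s+w]` with relative speed
`≤ Θ` at which `i` is NOT tagged (two thresholds) — the recurrent branch. -/
def uncAct₂ (Θ yc yk : ℝ) (K : ℕ) (Φ : Flow σ N) (τ s : ℝ) (i : Fin (N + 1)) (z : Cfg N) : ℝ :=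
  σ / τ * Φ.collisionPairSum (Set.Ioc s (s + window τ N))
    (fun t cfg k l => if k = i ∧ relSpeed cfg k l ≤ Θ ∧ ¬ Tagged₂ yc yk K cfg i then imp σ N cfg t k l else 0) z

/-! ## §1 Continuous approximation of the two-threshold untagged weight -/

section Weight

/-- The rank-`m` continuous approximation of the indicator of "`i` is untagged (two thresholds) at every scale below
`L`": the product over the scales `K' < L` of the clamps `min 1 (max 0 ·)` of `m (yc K' − rampCount)` and of
`m (yk K' − rampKinetic)`. -/
def untagApprox₂ (yc yk : ℝ) (K L : ℕ) (i : Fin (N + 1)) (m : ℕ) (cfg : Cfg N) : ℝ :=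
  ∏ K' ∈ scalesBelow K L,
    (min 1 (max 0 ((m : ℝ) * (yc * K' - rampCount (scaleRadius N K') i m cfg))) *
      min 1 (max 0 ((m : ℝ) * (yk * K' - rampKinetic (scaleRadius N K') i m cfg))))

/-- The approximants of the two-threshold untagged indicator are continuous. -/
theorem continuous_untagApprox₂ (yc yk : ℝ) (K L : ℕ) (i : Fin (N + 1)) (m : ℕ) :
    Continuous (untagApprox₂ yc yk K L i m) := by
  unfold untagApprox₂
  refine continuous_finsetProd _ fun K' _ => ?_
  exact (continuous_const.min (continuous_const.max (continuous_const.mul (continuous_const.sub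
    (continuous_rampCount _ i m))))).mul (continuous_const.min (continuous_const.max
      (continuous_const.mul (continuous_const.sub (continuous_rampKinetic _ i m)))))

/-- **The approximants converge to the truncated two-threshold untagged indicator**
`𝟙{∀ K' < L scale: nearCount < yc K' ∧ ballKinetic < yk K'}`. -/
theorem tendsto_untagApprox₂ (yc yk : ℝ) (K L : ℕ) (i : Fin (N + 1)) (cfg : Cfg N) :
    Tendsto (fun m => untagApprox₂ yc yk K L i m cfg) atTop
      (𝓝 (if ∀ K' ∈ scalesBelow K L, (nearCount cfg i (scaleRadius N K') : ℝ) < yc * K' ∧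
          ballKinetic cfg i (scaleRadius N K') < yk * K' then 1 else 0)) := by
  have h : ∀ K' ∈ scalesBelow K L, Tendsto (fun m : ℕ =>
      min 1 (max 0 ((m : ℝ) * (yc * K' - rampCount (scaleRadius N K') i m cfg))) *
        min 1 (max 0 ((m : ℝ) * (yk * K' - rampKinetic (scaleRadius N K') i m cfg)))) atTop
      (𝓝 (if (nearCount cfg i (scaleRadius N K') : ℝ) < yc * K' ∧
          ballKinetic cfg i (scaleRadius N K') < yk * K' then 1 else 0)) := by
    intro K' _
    have h1 := tendsto_clamp_mul_sub (yc * K') (tendsto_rampCount (scaleRadius N K') i cfg)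
      (natCast_nearCount_le_rampCount _ i cfg)
    have h2 := tendsto_clamp_mul_sub (yk * K') (tendsto_rampKinetic (scaleRadius N K') i cfg)
      (ballKinetic_le_rampKinetic _ i cfg)
    convert h1.mul h2 using 2
    rw [ite_zero_mul_ite_zero, one_mul]
  unfold untagApprox₂
  convert tendsto_finsetProd _ h using 2
  rw [Finset.prod_boole]

open scoped Classical in
/-- The **two-threshold untagged cold weight** of the ordered pair `(k, l)`:
`𝟙{k = i} 𝟙{relSpeed ≤ Θ} 𝟙{¬ Tagged₂ yc yk K cfg i}` (the indicator inside `uncAct₂`). -/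
def uncWeight₂ (Θ yc yk : ℝ) (K : ℕ) (i k l : Fin (N + 1)) (cfg : Cfg N) : ℝ :=
  if k = i ∧ relSpeed cfg k l ≤ Θ ∧ ¬ Tagged₂ yc yk K cfg i then 1 else 0

/-- The two-threshold untagged cold weight with the tagging truncated at the scales below `L`. -/
def uncWeightBelow₂ (Θ yc yk : ℝ) (K L : ℕ) (i k l : Fin (N + 1)) (cfg : Cfg N) : ℝ :=
  if k = i ∧ relSpeed cfg k l ≤ Θ ∧ ∀ K' ∈ scalesBelow K L, (nearCount cfg i (scaleRadius N K') : ℝ) < yc * K' ∧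
    ballKinetic cfg i (scaleRadius N K') < yk * K' then 1 else 0

/-- The rank-`m` CONTINUOUS approximation of the truncated weight: `𝟙{k = i} · ramp_m (relSpeed) · untagApprox₂`. -/
def uncWeightApprox₂ (Θ yc yk : ℝ) (K L : ℕ) (i : Fin (N + 1)) (m : ℕ) (k l : Fin (N + 1)) (cfg : Cfg N) : ℝ :=
  (if k = i then 1 else 0) * ramp Θ m (relSpeed cfg k l) * untagApprox₂ yc yk K L i m cfg

/-- The approximating weights are continuous. -/
theorem continuous_uncWeightApprox₂ (Θ yc yk : ℝ) (K L : ℕ) (i : Fin (N + 1)) (m : ℕ) (k l : Fin (N + 1)) :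
    Continuous (uncWeightApprox₂ Θ yc yk K L i m k l) :=
  (continuous_const.mul ((continuous_ramp Θ m).comp (continuous_relSpeed_config k l))).mul
    (continuous_untagApprox₂ yc yk K L i m)

/-- **First limit (`m → ∞`, `L` fixed):** the continuous weights converge to the truncated weight. -/
theorem tendsto_uncWeightApprox₂ (Θ yc yk : ℝ) (K L : ℕ) (i k l : Fin (N + 1)) (cfg : Cfg N) :
    Tendsto (fun m => uncWeightApprox₂ Θ yc yk K L i m k l cfg) atTop
      (𝓝 (uncWeightBelow₂ Θ yc yk K L i k l cfg)) := by
  have h := ((tendsto_const_nhds (x := if k = i then (1 : ℝ) else 0)).mul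
    (tendsto_ramp Θ (relSpeed cfg k l))).mul (tendsto_untagApprox₂ yc yk K L i cfg)
  unfold uncWeightApprox₂ uncWeightBelow₂
  convert h using 2
  rw [ite_zero_mul_ite_zero, ite_zero_mul_ite_zero, mul_one, mul_one]
  simp only [and_assoc]

/-- **Second limit (`L → ∞`):** the truncated weights are eventually equal to the two-threshold untagged cold weight (a
tagged particle is tagged at some scale `K'`, hence below every `L > K'`; an untagged one is untagged below every `L`). -/
theorem tendsto_uncWeightBelow₂ (Θ yc yk : ℝ) (K : ℕ) (i k l : Fin (N + 1)) (cfg : Cfg N) :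
    Tendsto (fun L => uncWeightBelow₂ Θ yc yk K L i k l cfg) atTop (𝓝 (uncWeight₂ Θ yc yk K i k l cfg)) := by
  unfold uncWeightBelow₂ uncWeight₂
  by_cases ht : Tagged₂ yc yk K cfg i
  · have ht' := ht
    obtain ⟨K', hKK', h1K', hor⟩ := ht'
    refine tendsto_const_nhds.congr' ?_
    filter_upwards [eventually_gt_atTop K'] with L hL
    have hK' : K' ∈ scalesBelow K L := Finset.mem_filter.2 ⟨Finset.mem_range.2 hL, hKK', h1K'⟩
    rw [if_neg fun h => h.2.2 ht, if_neg fun h => ?_]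
    rcases hor with hle | hle
    · exact (not_le.2 (h.2.2 K' hK').1) hle
    · exact (not_le.2 (h.2.2 K' hK').2) hle
  · have hall : ∀ L, ∀ K' ∈ scalesBelow K L, (nearCount cfg i (scaleRadius N K') : ℝ) < yc * K' ∧
        ballKinetic cfg i (scaleRadius N K') < yk * K' := by
      intro L K' hK'
      by_contra hcon
      refine ht ⟨K', (Finset.mem_filter.1 hK').2.1, (Finset.mem_filter.1 hK').2.2, ?_⟩
      rcases not_and_or.1 hcon with hc | hk
      · exact Or.inl (not_lt.1 hc)
      · exact Or.inr (not_lt.1 hk)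
    refine tendsto_const_nhds.congr fun L => ?_
    by_cases hkr : k = i ∧ relSpeed cfg k l ≤ Θ
    · rw [if_pos ⟨hkr.1, hkr.2, ht⟩, if_pos ⟨hkr.1, hkr.2, hall L⟩]
    · rw [if_neg fun h => hkr ⟨h.1, h.2.1⟩, if_neg fun h => hkr ⟨h.1, h.2.1⟩]

end Weight

/-! ## §2 Weighted impulse sums along the flow: the two limits and the identification with `uncAct₂` -/

section FlowSums

/-- **The two-threshold untagged cold weight is admissible:** the weighted impulse pair sum with weight
`uncWeight₂ Θ yc yk K i`, extended by `0` off the good set, is measurable (engine on the continuous approximants, then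
the two limits `m → ∞`, `L → ∞`). -/
theorem measurable_indicator_impulsePairSum_uncWeight₂ (Φ : Flow σ N) (a b Θ yc yk : ℝ) (K : ℕ)
    (i : Fin (N + 1)) : Measurable (Φ.good.indicator (impulsePairSum Φ a b (uncWeight₂ Θ yc yk K i))) :=
  measurable_indicator_impulsePairSum_of_tendsto Φ a b (W := fun L => uncWeightBelow₂ Θ yc yk K L i)
    (fun k l cfg => tendsto_uncWeightBelow₂ Θ yc yk K i k l cfg) fun L =>
      measurable_indicator_impulsePairSum_of_tendsto Φ a b (W := fun m => uncWeightApprox₂ Θ yc yk K L i m)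
        (fun k l cfg => tendsto_uncWeightApprox₂ Θ yc yk K L i k l cfg) fun m =>
          measurable_indicator_impulsePairSum_of_continuous Φ a b fun k l =>
            continuous_uncWeightApprox₂ Θ yc yk K L i m k l

/-- **`uncAct₂` as a weighted impulse pair sum.** On the good set,
`uncAct₂ Θ yc yk K Φ τ s i z = (σ/τ) · impulsePairSum Φ s (s + w) (uncWeight₂ Θ yc yk K i) z`: both are finite sums
over the collisions of the orbit in the window, and the recorded pre-collisional velocity of `imp` is the left limit
(`IsHardSphereTrajectory.ofConfig_preVel_eq_leftLim`). -/
theorem uncAct₂_eq_impulsePairSum (Θ yc yk : ℝ) (K : ℕ) (Φ : Flow σ N) (τ s : ℝ) (i : Fin (N + 1)) {z : Cfg N}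
    (hz : z ∈ Φ.good) :
    uncAct₂ Θ yc yk K Φ τ s i z = σ / τ * impulsePairSum Φ s (s + window τ N) (uncWeight₂ Θ yc yk K i) z := by
  have hγ := Φ.isTrajectory z hz
  have hfin : (collisionTimes (Torus.geometry (Fin 3)) (hsDiameter σ N) (fun t => Φ.flow t z) ∩
      Ioc s (s + window τ N)).Finite := Φ.finite_collisionTimes_inter hz Ioc_subset_Icc_self
  unfold uncAct₂ HardSphereFlow.collisionPairSum impulsePairSum
  congr 1
  simp only [collisionPairSum_eq_finset_sum hfin]
  refine Finset.sum_congr rfl fun t _ => Finset.sum_congr rfl fun p hp => ?_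
  obtain ⟨k, l⟩ := p
  dsimp only
  unfold imp Summit.AtomisticToContinuum.HydrodynamicLimit.Theorems.CollisionActivityTailsPlaqueSplit.rec
  rw [hγ.ofConfig_preVel_eq_leftLim hp]
  simp only [HardSphereCollisionRecord.ofConfig_postVel]
  unfold uncWeight₂
  split_ifs <;> simp

/-- **Measurability of the two-threshold untagged cold activity in the initial datum.** For every flow, caps, window,
start and particle, `uncAct₂ Θ yc yk K Φ τ s i`, extended by `0` off the good set, is measurable. -/
theorem measurable_indicator_uncAct₂ (Φ : Flow σ N) (Θ yc yk : ℝ) (K : ℕ) (τ s : ℝ) (i : Fin (N + 1)) :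
    Measurable (Φ.good.indicator fun z => uncAct₂ Θ yc yk K Φ τ s i z) := by
  have h : Φ.good.indicator (fun z => uncAct₂ Θ yc yk K Φ τ s i z) =
      fun z => σ / τ * Φ.good.indicator (impulsePairSum Φ s (s + window τ N) (uncWeight₂ Θ yc yk K i)) z := by
    funext z
    by_cases hz : z ∈ Φ.good
    · rw [indicator_of_mem hz, indicator_of_mem hz, uncAct₂_eq_impulsePairSum Θ yc yk K Φ τ s i hz]
    · rw [indicator_of_notMem hz, indicator_of_notMem hz, mul_zero]
  rw [h]
  exact (measurable_indicator_impulsePairSum_uncWeight₂ Φ s _ Θ yc yk K i).const_mul _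

end FlowSums

/-! ## §3 The registered statement (VERBATIM copy of the skeleton's `UncActMeasurable₂`) -/

/-- **STUB M₂ — MEASURABILITY OF THE UNTAGGED COLD ACTIVITY** (statement verbatim from the skeleton, two thresholds):
law-free — for every diameter, particle number, flow, caps `Θ, yc, yk, K`, window `τ`, start `s` and particle `i`, the
untagged cold activity, extended by `0` off the good set, is measurable in the initial datum. -/
def UncActMeasurable₂ : Prop :=
  ∀ (σ : ℝ) (N : ℕ) (Φ : Flow σ N) (Θ yc yk : ℝ) (K : ℕ) (τ s : ℝ) (i : Fin (N + 1)),
    Measurable (Φ.good.indicator fun z => uncAct₂ Θ yc yk K Φ τ s i z)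

/-- **STUB M₂ (line `plaque-thinning-count-ld`), proved.** The two-threshold untagged cold activity, extended by `0` off
the good set, is measurable in the initial datum, for all data (`measurable_indicator_uncAct₂`). -/
theorem stub_uncActMeasurableTT : UncActMeasurable₂ :=
  fun _ _ Φ Θ yc yk K τ s i => measurable_indicator_uncAct₂ Φ Θ yc yk K τ s i

end Summit.AtomisticToContinuum.HydrodynamicLimit.Theorems.CollisionActivityTailsUncActMeasurableTT

end
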